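import Mathlib

/-!
# Left-kernel vectors bound the rank (negative-side linear-algebra lemma for the crux `SubgroupIdentityDesigns`,
stmt-MatrixMultiplication-14079; cell B2b-5, gen 7 — report `run/shared/lean/b2b/levelgraded-cu/ORACLE-g7.md` §G7-1, filter FL)

The abstract content of a LEFT-KERNEL RANK CERTIFICATE: if `R : ι → (S → K)` is a finite family of row vectors and
`α₁, …, α_k : ι → K` are linearly independent coefficient vectors with `∑ i, α_j i • R i = 0` for every `j`, then
`finrank (span (range R)) + k ≤ |ι|` (`finrank_span_add_le_card`).  In the census `R` = the 1440 fibre-indicator rows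
restricted to `S = H₁H₂H₃`, the `α_j` are the certificate's integer relations (checked on every `s ∈ S` by
`verify_lker.py`), so `rank_ℚ M_S ≤ 1440 - k`; together with `RankSplit.finrank_eq_card_add_finrank_restrict` and
`DesignTranslate.levelOne_design_translate` this is the FAIL criterion `1440 - k < |H₁H₃| + rank M_{S∖H₁H₃}`.
Sorry-free.  VALUE = soundness lemma for a certificate format, NOT summit progress.
-/

set_option linter.dupNamespace false

open scoped BigOperators Classical

namespace Summit.MatrixMultiplication.MatrixMultiplication.Theorems.SubgroupIdentityDesigns.Negative

namespace LeftKernelBound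

variable {K : Type*} [Field K] {S : Type*} {ι : Type*} [Fintype ι] [DecidableEq ι]

/-- The combination map `β ↦ ∑ i, β i • R i` has range the span of the rows. -/
theorem range_combination_eq_span (R : ι → (S → K)) :
    LinearMap.range (∑ i : ι, (LinearMap.proj i : (ι → K) →ₗ[K] K).smulRight (R i)) =
      Submodule.span K (Set.range R) := by
  apply le_antisymm
  · rintro _ ⟨β, rfl⟩
    simp only [LinearMap.coe_sum, Finset.sum_apply, LinearMap.smulRight_apply, LinearMap.proj_apply]
    exact Submodule.sum_mem _ fun i _ => Submodule.smul_mem _ _ (Submodule.subset_span ⟨i, rfl⟩)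
  · rw [Submodule.span_le]
    rintro _ ⟨i, rfl⟩
    refine ⟨Pi.single i 1, ?_⟩
    simp only [LinearMap.coe_sum, Finset.sum_apply, LinearMap.smulRight_apply, LinearMap.proj_apply]
    rw [Finset.sum_eq_single i]
    · simp
    · intro j _ hj; simp [hj]
    · intro h; exact absurd (Finset.mem_univ i) h

/-- LEFT-KERNEL BOUND.  `k` linearly independent relations among the rows `R i` force
`finrank (span (range R)) + k ≤ |ι|`. -/
theorem finrank_span_add_le_card (R : ι → (S → K)) {k : ℕ} (α : Fin k → (ι → K))
    (hα : LinearIndependent K α) (hker : ∀ j, ∑ i, α j i • R i = 0) :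
    Module.finrank K (Submodule.span K (Set.range R)) + k ≤ Fintype.card ι := by
  set Φ : (ι → K) →ₗ[K] (S → K) := ∑ i : ι, (LinearMap.proj i : (ι → K) →ₗ[K] K).smulRight (R i) with hΦ
  have hΦapp : ∀ β : ι → K, Φ β = ∑ i, β i • R i := by
    intro β
    simp only [hΦ, LinearMap.coe_sum, Finset.sum_apply, LinearMap.smulRight_apply, LinearMap.proj_apply]
  have hrn := LinearMap.finrank_range_add_finrank_ker Φ
  have hrange : LinearMap.range Φ = Submodule.span K (Set.range R) := range_combination_eq_span R
  have hdom : Module.finrank K (ι → K) = Fintype.card ι := Module.finrank_fintype_fun_eq_card K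
  have hk : k ≤ Module.finrank K (LinearMap.ker Φ) := by
    have hsub : Submodule.span K (Set.range α) ≤ LinearMap.ker Φ := by
      rw [Submodule.span_le]
      rintro _ ⟨j, rfl⟩
      rw [SetLike.mem_coe, LinearMap.mem_ker, hΦapp]
      exact hker j
    calc k = Fintype.card (Fin k) := (Fintype.card_fin k).symm
      _ = Module.finrank K (Submodule.span K (Set.range α)) := (finrank_span_eq_card hα).symm
      _ ≤ Module.finrank K (LinearMap.ker Φ) := Submodule.finrank_mono hsub
  rw [hrange, hdom] at hrn
  omega

end LeftKernelBound

end Summit.MatrixMultiplication.MatrixMultiplication.Theorems.SubgroupIdentityDesigns.Negative
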